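import Mathlib

/-!
# Tier4/Line1/RotationGram — LINE L1: the Gram matrix of a hermitian plane on an adapted basis (t4-L1-p3)

Blind re-derivation cell `pub-hodge-repro`, Tier 4 (README §9–§10), seat t4-L1-p3.  Generic linear algebra over a
field `k` of characteristic `0` (Mathlib only, no printed input), the first half of the rational ROTATION that closes the
«declared wall» J2.d′-i `exists_regular_rational` of the line (STATUS.md S12438 (b), S12500 — the module
`Tier4/Line1/RegularElement.lean` assembles it): for a symmetric `B`, an `Om` with `Om² = −d` and the hermitian-trace
relation `Omᵀ B = −B Om`, the pairing `β(u, v) = u ⬝ᵥ (B *ᵥ v)` satisfies `β(Om u, v) = −β(u, Om v)`, `β(u, Om u) = 0`,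
`β(Om u, Om v) = d β(u, v)`; on the adapted basis `x, Om x, y, Om y` of two `B`-orthogonal `Om`-lines its Gram matrix is
`diag(α, dα, β, dβ)` (`gram_adapted`); `Om` acts on that basis by `diag(J, J)`, `J = [[0, −d], [1, 0]]`
(`mul_adapted_eq`); and the rotation block matrix `R(c, s, s')` commutes with `diag(J, J)` (`rot_comm_J`) and is an
isometry of `diag(α, dα, β, dβ)` when `c²α + s²β = α`, `s'α = sβ` (`rot_isometry`).

Nothing here says anything about the status of the Hodge conjecture for CM abelian varieties, which is NOT proved
(HC_CM is NOT proved by anyone in this repository).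
-/

set_option autoImplicit false

noncomputable section

namespace Summit.Ventures.HodgeRepro.Tier4.Line1.Rot

open Matrix

variable {k : Type} [Field k] [CharZero k]


omit [CharZero k] in
/-- the entry of `Sᵀ B S` is the `B`-pairing of two columns of `S`. -/
theorem transpose_mul_mul_apply (S B : Matrix (Fin 4) (Fin 4) k) (i j : Fin 4) :
    (Sᵀ * B * S) i j = (fun a => S a i) ⬝ᵥ (B *ᵥ fun b => S b j) := by
  simp only [Matrix.mul_apply, Matrix.transpose_apply, dotProduct, Matrix.mulVec, Finset.sum_mul,
    Finset.mul_sum]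
  rw [Finset.sum_comm]
  refine Finset.sum_congr rfl fun a _ => Finset.sum_congr rfl fun b _ => by ring

omit [CharZero k] in
/-- hermitian relation: `β(Om u, v) = -β(u, Om v)` for `Omᵀ B = -(B Om)`. -/
theorem pair_mulVec_left {B Om : Matrix (Fin 4) (Fin 4) k} (hherm : Omᵀ * B = -(B * Om))
    (u v : Fin 4 → k) : (Om *ᵥ u) ⬝ᵥ (B *ᵥ v) = -(u ⬝ᵥ (B *ᵥ (Om *ᵥ v))) := by
  rw [← vecMul_transpose, ← dotProduct_mulVec, mulVec_mulVec, hherm, neg_mulVec, dotProduct_neg,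
    ← mulVec_mulVec]

omit [CharZero k] in
/-- symmetry of the pairing for symmetric `B`. -/
theorem pair_comm {B : Matrix (Fin 4) (Fin 4) k} (hB : Bᵀ = B) (u v : Fin 4 → k) :
    u ⬝ᵥ (B *ᵥ v) = v ⬝ᵥ (B *ᵥ u) := by
  rw [dotProduct_mulVec, ← mulVec_transpose, hB, dotProduct_comm]

/-- `β(u, Om u) = 0`. -/
theorem pair_mulVec_self {B Om : Matrix (Fin 4) (Fin 4) k} (hB : Bᵀ = B)
    (hherm : Omᵀ * B = -(B * Om)) (u : Fin 4 → k) : u ⬝ᵥ (B *ᵥ (Om *ᵥ u)) = 0 := by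
  have h := pair_mulVec_left hherm u u
  rw [pair_comm hB] at h
  -- h : u ⬝ᵥ (B *ᵥ (Om *ᵥ u)) = -(u ⬝ᵥ (B *ᵥ (Om *ᵥ u)))
  have h2 : (2 : k) * (u ⬝ᵥ (B *ᵥ (Om *ᵥ u))) = 0 := by linear_combination h
  rcases mul_eq_zero.mp h2 with h0 | h0
  · exact absurd h0 two_ne_zero
  · exact h0

omit [CharZero k] in
/-- `β(Om u, Om v) = d β(u, v)` when `Om² = -d`. -/
theorem pair_mulVec_mulVec {B Om : Matrix (Fin 4) (Fin 4) k} {d : k}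
    (hherm : Omᵀ * B = -(B * Om)) (hOm : Om * Om = -(d • (1 : Matrix (Fin 4) (Fin 4) k)))
    (u v : Fin 4 → k) : (Om *ᵥ u) ⬝ᵥ (B *ᵥ (Om *ᵥ v)) = d * (u ⬝ᵥ (B *ᵥ v)) := by
  rw [pair_mulVec_left hherm, mulVec_mulVec v Om Om, hOm, neg_mulVec, smul_mulVec, one_mulVec,
    mulVec_neg, mulVec_smul, dotProduct_neg, dotProduct_smul, neg_neg, smul_eq_mul]

/-- the Gram matrix of `B` on the adapted basis `x, Om x, y, Om y` of two `B`-orthogonal `Om`-lines is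
`diag(α, dα, β, dβ)`. -/
theorem gram_adapted {B Om : Matrix (Fin 4) (Fin 4) k} {d : k} (hB : Bᵀ = B)
    (hherm : Omᵀ * B = -(B * Om)) (hOm : Om * Om = -(d • (1 : Matrix (Fin 4) (Fin 4) k)))
    (x y : Fin 4 → k) (hxy : x ⬝ᵥ (B *ᵥ y) = 0) (hxOy : x ⬝ᵥ (B *ᵥ (Om *ᵥ y)) = 0) :
    let S : Matrix (Fin 4) (Fin 4) k := Matrix.of fun i j => ![x, Om *ᵥ x, y, Om *ᵥ y] j i
    Sᵀ * B * S = Matrix.diagonal ![x ⬝ᵥ (B *ᵥ x), d * (x ⬝ᵥ (B *ᵥ x)), y ⬝ᵥ (B *ᵥ y),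
      d * (y ⬝ᵥ (B *ᵥ y))] := by
  intro S
  have hyx : y ⬝ᵥ (B *ᵥ x) = 0 := by rw [pair_comm hB]; exact hxy
  have hOyx : (Om *ᵥ y) ⬝ᵥ (B *ᵥ x) = 0 := by rw [pair_comm hB]; exact hxOy
  have hOxy : (Om *ᵥ x) ⬝ᵥ (B *ᵥ y) = 0 := by
    rw [pair_mulVec_left hherm, hxOy, neg_zero]
  have hyOx : y ⬝ᵥ (B *ᵥ (Om *ᵥ x)) = 0 := by rw [pair_comm hB]; exact hOxy
  have hOxOy : (Om *ᵥ x) ⬝ᵥ (B *ᵥ (Om *ᵥ y)) = 0 := by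
    rw [pair_mulVec_mulVec hherm hOm, hxy, mul_zero]
  have hOyOx : (Om *ᵥ y) ⬝ᵥ (B *ᵥ (Om *ᵥ x)) = 0 := by rw [pair_comm hB]; exact hOxOy
  have hxOx := pair_mulVec_self hB hherm x
  have hOxx : (Om *ᵥ x) ⬝ᵥ (B *ᵥ x) = 0 := by rw [pair_comm hB]; exact hxOx
  have hyOy := pair_mulVec_self hB hherm y
  have hOyy : (Om *ᵥ y) ⬝ᵥ (B *ᵥ y) = 0 := by rw [pair_comm hB]; exact hyOy
  have hOxOx := pair_mulVec_mulVec hherm hOm x x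
  have hOyOy := pair_mulVec_mulVec hherm hOm y y
  have hcol : ∀ j, (fun a => S a j) = ![x, Om *ᵥ x, y, Om *ᵥ y] j := fun j => rfl
  ext i j
  rw [transpose_mul_mul_apply, hcol, hcol]
  fin_cases i <;> fin_cases j <;>
    simp [Matrix.diagonal, hxy, hxOy, hyx, hOyx, hOxy, hyOx, hOxOy, hOyOx, hxOx, hOxx, hyOy, hOyy,
      hOxOx, hOyOy, -Matrix.mulVec_mulVec]



omit [CharZero k] in
/-- `Om S = S Jb`: the matrix of `Om` on the adapted basis is `diag(J, J)`, `J = [[0, -d], [1, 0]]`. -/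
theorem mul_adapted_eq {Om : Matrix (Fin 4) (Fin 4) k} {d : k}
    (hOm : Om * Om = -(d • (1 : Matrix (Fin 4) (Fin 4) k))) (x y : Fin 4 → k) :
    Om * Matrix.of (fun i j => ![x, Om *ᵥ x, y, Om *ᵥ y] j i) =
      Matrix.of (fun i j => ![x, Om *ᵥ x, y, Om *ᵥ y] j i) *
        Matrix.of ![![0, -d, 0, 0], ![1, 0, 0, 0], ![0, 0, 0, -d], ![0, 0, 1, 0]] := by
  have h2x : Om *ᵥ (Om *ᵥ x) = (-d) • x := by
    rw [mulVec_mulVec, hOm, neg_mulVec, smul_mulVec, one_mulVec, neg_smul]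
  have h2y : Om *ᵥ (Om *ᵥ y) = (-d) • y := by
    rw [mulVec_mulVec, hOm, neg_mulVec, smul_mulVec, one_mulVec, neg_smul]
  ext i j
  have hcol : ∀ j, (Om * Matrix.of (fun i j => ![x, Om *ᵥ x, y, Om *ᵥ y] j i)) i j =
      (Om *ᵥ (![x, Om *ᵥ x, y, Om *ᵥ y] j)) i := by
    intro j
    simp only [Matrix.mul_apply, Matrix.of_apply, Matrix.mulVec, dotProduct]
  rw [hcol]
  fin_cases j <;> simp [Matrix.mul_apply, Fin.sum_univ_four, h2x, h2y, mul_comm]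

omit [CharZero k] in
/-- the rotation block matrix commutes with `diag(J, J)`. -/
theorem rot_comm_J (c s s' d : k) :
    Matrix.of ![![c, 0, -s', 0], ![0, c, 0, -s'], ![s, 0, c, 0], ![0, s, 0, c]] *
        Matrix.of ![![0, -d, 0, 0], ![1, 0, 0, 0], ![0, 0, 0, -d], ![0, 0, 1, 0]] =
      Matrix.of ![![0, -d, 0, 0], ![1, 0, 0, 0], ![0, 0, 0, -d], ![0, 0, 1, 0]] *
        Matrix.of ![![c, 0, -s', 0], ![0, c, 0, -s'], ![s, 0, c, 0], ![0, s, 0, c]] := by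
  ext i j
  fin_cases i <;> fin_cases j <;> simp [Matrix.mul_apply, Fin.sum_univ_four] <;> ring

omit [CharZero k] in
/-- the rotation block matrix is an isometry of `diag(α, dα, β, dβ)` when `c²α + s²β = α` and `s'α = sβ`. -/
theorem rot_isometry {c s s' d α β : k} (hα : α ≠ 0) (hc : c * c * α + s * s * β = α)
    (hs' : s' * α = s * β) :
    (Matrix.of ![![c, 0, -s', 0], ![0, c, 0, -s'], ![s, 0, c, 0], ![0, s, 0, c]])ᵀ *
        Matrix.diagonal ![α, d * α, β, d * β] *
        Matrix.of ![![c, 0, -s', 0], ![0, c, 0, -s'], ![s, 0, c, 0], ![0, s, 0, c]] =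
      Matrix.diagonal ![α, d * α, β, d * β] := by
  have h22 : s' * s' * α + c * c * β = β := by
    apply mul_left_cancel₀ hα
    linear_combination (s' * α + s * β) * hs' + β * hc
  have h02 : -(c * s' * α) + s * c * β = 0 := by linear_combination (-c) * hs'
  ext i j
  fin_cases i <;> fin_cases j <;>
    simp [Matrix.mul_apply, Fin.sum_univ_four, Matrix.diagonal] <;>
    first
    | linear_combination hc
    | linear_combination d * hc
    | linear_combination h22
    | linear_combination d * h22
    | linear_combination h02
    | linear_combination d * h02


end Summit.Ventures.HodgeRepro.Tier4.Line1.Rot
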